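import Summits.QuantumFields.GaugeBoot.DiagonalRPTorusHexCert
import Summits.QuantumFields.GaugeBoot.DiagonalRPTorusReplicaForest
import HarnessLib

/-!
# Small joining clusters of the bent-hexagon pair are the annulus (gauge-boot, L3 `d = 3` uniform window, J1 brick 4/4)

HONEST FRAMING (cell `pub-gaugeboot`, page 1 of every file): the venture produces certified bounds
on lattice expectations at stated coupling, gauge group, dimension and torus size; NOT a mass gap,
NOT a continuum limit, NOT a string tension; NOT Yang–Mills-summit-bearing (barriers
`FixedCouplingUltralocality`, `PerturbativeInvisibility`). This module is bookkeeping for a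
structural NEGATIVE result (a coupling window UNIFORM in the torus size for the failure of
inner-half diagonal reflection positivity on `(ℤ/L)^3`); it proves no window and evaluates no
cluster integral.

## Content (torus `(ℤ/L)^3`, `L = 2c`, `c ≥ 15`, base `y` on the layer `δ(y) = y₀ - y₁ = c - 1`)

(J1) of the plan note `HOME/pub-gaugeboot-lean3/gen46/D3-UNIFORM-PLAN.md` §3 item 6c, ON THE
TORUS:

* `hexLinks y` — the six links of the bent hexagon `γ_y = ∂[(y;1,2) ∪ (y+e₁;0,2)]`;
  `Et_LE₂ : Et y LE₂ = hexLinks y` and `Et_LE₁` (the chart data of brick 3 ARE the hexagon at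
  `y` and the mirror image `θγ_{y₀}`, `θ y₀ = y + 2e₀`); `hexTube y = Pt y tubeT` (the annulus).
* ★★ **`eq_hexTube_or_hasForestSplit`** — every `Q ⊆ restPlaqs 0 1 c` with `#Q ≤ 10` is the
  annulus or has a forest split for `(Et y LE₁, Et y LE₂)` (bricks 2 + 3: the kernel-checked
  decision tree and its soundness).
* `hexTube_subset_restPlaqs`, `card_hexTube`, `tjoins_hexTube` — the annulus is an admissible
  joining cluster of size `10`.
* ★★ **`sum_replicaTerm_small_eq_hexTube`** — for bounded measurable observables `f`, `g`
  reading `Et y LE₁`, `Et y LE₂`, `f` gauge invariant, and every complex coupling `z`: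
  `Σ_{Q ⊆ rest, Q joins, #Q ≤ 10} replicaTerm f g Q z = replicaTerm f g (hexTube y) z`
  (the doubled forest principle `DiagRPUnif.replicaTerm_eq_zero_of_forestSplit` kills every
  other term). This is the `m = 10` input of `DiagRPUnif.restTruncC_jet_of_smallClusters` up to
  the jet of the single annulus term ((J2), open).

Elementary given bricks 1–3 and the Literature layer; no named fact.
-/

open MeasureTheory Finset Function

namespace Summit.QuantumFields.GaugeBoot

open Literature.MathematicalPhysics.QuantumFieldTheory

noncomputable section

namespace DiagRPHex

open DiagRPTube DiagRPUnif

variable {L : ℕ}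

/-! ## The hexagon, its mirror image and the annulus on the torus -/

/-- The six links of the bent hexagon `γ_y : y → y+e₂ → y+e₂+e₁ → y+e₀+e₁+e₂ → y+e₀+e₁ → y+e₁ → y`,
the boundary of the two inner faces `(y;1,2)`, `(y+e₁;0,2)` of the unit cube at `y`. -/
def hexLinks (y : Site 3 L) : Finset (Edge 3 L) :=
  {(y, 2), (y.shift 2, 1), ((y.shift 1).shift 2, 0), ((y.shift 0).shift 1, 2), (y.shift 1, 0), (y, 1)}

/-- The ten-face annulus between `γ_y` and the mirror-image hexagon two units across the back
layer: the chart image of `tubeT`. -/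
def hexTube (y : Site 3 L) : Finset (Plaquette 3 L) := Pt y tubeT

variable (y : Site 3 L)

/-- ★ The chart data `LE₂` is the hexagon at the base. -/
theorem Et_LE₂ : Et y LE₂ = hexLinks y := by
  ext e
  simp only [Et, LE₂, hexLinks, List.map_cons, List.map_nil, List.toFinset_cons, List.toFinset_nil,
    insert_empty_eq, mem_insert, mem_singleton, edge]
  have h0 : site y (0, 0, 0) = y := by
    funext k; fin_cases k <;> simp [site]
  have h2 : site y (0, 0, 1) = y.shift 2 := by
    rw [show ((0 : ℤ), (0 : ℤ), (1 : ℤ)) = (0, 0, 0) + lvec 2 by simp [lvec], site_add_lvec, h0]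
  have h12 : site y (0, 1, 1) = (y.shift 1).shift 2 := by
    rw [show ((0 : ℤ), (1 : ℤ), (1 : ℤ)) = (0, 0, 0) + lvec 1 + lvec 2 by simp [lvec], site_add_lvec,
      site_add_lvec, h0]
  have h01 : site y (1, 1, 0) = (y.shift 0).shift 1 := by
    rw [show ((1 : ℤ), (1 : ℤ), (0 : ℤ)) = (0, 0, 0) + lvec 0 + lvec 1 by simp [lvec], site_add_lvec,
      site_add_lvec, h0]
  have h1 : site y (0, 1, 0) = y.shift 1 := by
    rw [show ((0 : ℤ), (1 : ℤ), (0 : ℤ)) = (0, 0, 0) + lvec 1 by simp [lvec], site_add_lvec, h0]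
  simp only [h0, h2, h12, h01, h1]

/-- ★ The chart data `LE₁` is the mirror image `θγ_{y₀}` of the hexagon at `y₀ = θ(y + 2e₀)`
(so that `θ y₀ = y + 2e₀`): its links are the `θ`-images of `hexLinks y₀`. -/
theorem Et_LE₁ :
    Et y LE₁ = (hexLinks (siteDiagSwap (0 : Fin 3) 1 ((y.shift 0).shift 0))).image
      (edgeDiagSwap (0 : Fin 3) 1) := by
  -- `θ` on the six links, written at `w = y + 2e₀ = θ y₀`
  set w := (y.shift 0).shift 0 with hw
  have hsw : siteDiagSwap (0 : Fin 3) 1 (siteDiagSwap (0 : Fin 3) 1 w) = w := siteDiagSwap_siteDiagSwap _ _ _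
  have himg : (hexLinks (siteDiagSwap (0 : Fin 3) 1 w)).image (edgeDiagSwap (0 : Fin 3) 1) =
      {(w, 2), (w.shift 2, 0), ((w.shift 0).shift 2, 1), ((w.shift 1).shift 0, 2), (w.shift 0, 1), (w, 0)} := by
    simp only [hexLinks, image_insert, image_singleton, edgeDiagSwap, siteDiagSwap_shift, hsw]
    simp [Equiv.swap_apply_left, Equiv.swap_apply_right, Equiv.swap_apply_of_ne_of_ne]
  rw [himg]
  ext e
  simp only [Et, LE₁, List.map_cons, List.map_nil, List.toFinset_cons, List.toFinset_nil,
    insert_empty_eq, mem_insert, mem_singleton, edge]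
  have h0 : site y (0, 0, 0) = y := by
    funext k; fin_cases k <;> simp [site]
  have hw' : site y (2, 0, 0) = w := by
    rw [show ((2 : ℤ), (0 : ℤ), (0 : ℤ)) = (0, 0, 0) + lvec 0 + lvec 0 by simp [lvec], site_add_lvec,
      site_add_lvec, h0]
  have h201 : site y (2, 0, 1) = w.shift 2 := by
    rw [show ((2 : ℤ), (0 : ℤ), (1 : ℤ)) = (2, 0, 0) + lvec 2 by simp [lvec], site_add_lvec, hw']
  have h301 : site y (3, 0, 1) = (w.shift 0).shift 2 := by
    rw [show ((3 : ℤ), (0 : ℤ), (1 : ℤ)) = (2, 0, 0) + lvec 0 + lvec 2 by simp [lvec], site_add_lvec,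
      site_add_lvec, hw']
  have h310 : site y (3, 1, 0) = (w.shift 1).shift 0 := by
    rw [show ((3 : ℤ), (1 : ℤ), (0 : ℤ)) = (2, 0, 0) + lvec 1 + lvec 0 by simp [lvec], site_add_lvec,
      site_add_lvec, hw']
  have h300 : site y (3, 0, 0) = w.shift 0 := by
    rw [show ((3 : ℤ), (0 : ℤ), (0 : ℤ)) = (2, 0, 0) + lvec 0 by simp [lvec], site_add_lvec, hw']
  simp only [hw', h201, h301, h310, h300]

/-! ## (J1) on the torus -/

variable {y} [NeZero L] {c : ℕ}

/-- ★★ **(J1): every set of at most ten rest plaquettes is the annulus or has a forest split**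
for the pair (mirror-image hexagon, hexagon). -/
theorem eq_hexTube_or_hasForestSplit (hc : 15 ≤ c) (hL : L = 2 * c)
    (hy : lay (0 : Fin 3) 1 y = ((c - 1 : ℕ) : ZMod L)) {Q : Finset (Plaquette 3 L)}
    (hQ : Q ⊆ restPlaqs (0 : Fin 3) 1 c) (hQ10 : Q.card ≤ 10) :
    Q = hexTube y ∨ HasForestSplit (Et y LE₁) (Et y LE₂) Q :=
  eq_tube_or_hasForestSplit_of_check (B := 4) (by omega) hL hy inBox_LE₁ inBox_LE₂ check_hexCert hQ hQ10

/-- The annulus consists of rest plaquettes. -/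
theorem hexTube_subset_restPlaqs (hc : 15 ≤ c) (hL : L = 2 * c)
    (hy : lay (0 : Fin 3) 1 y = ((c - 1 : ℕ) : ZMod L)) : hexTube y ⊆ restPlaqs (0 : Fin 3) 1 c := by
  intro q hq
  obtain ⟨p, hp, rfl⟩ := mem_Pt.1 hq
  have h : (tubeT.all fun p => lrest p) = true := by decide +kernel
  exact mem_restPlaqs_of_lrest (by omega) hL hy ((List.all_eq_true.1 h) p hp)

omit [NeZero L] in
/-- The annulus has ten faces (`L > 8`). -/
theorem card_hexTube (hL : 8 < L) : (hexTube y).card = 10 := by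
  have hnd : tubeT.Nodup := by decide +kernel
  have h := card_Pt (y := y) (B := 4) (by omega) inBox_tubeT hnd
  unfold hexTube
  rw [h]
  rfl

omit [NeZero L] in
/-- Adjacency of charted plaquettes from a local link equation. -/
theorem padj_plaq_of_llink {p q : LPlaq} {a b : Fin 4} (h : llink p a = llink q b) :
    padj (plaq y p) (plaq y q) :=
  ⟨a, b, by rw [link_plaq, link_plaq, h]⟩

omit [NeZero L] in
/-- The annulus joins the two hexagons. -/
theorem tjoins_hexTube : TJoins (hexTube y) (Et y LE₁) (Et y LE₂) := by
  -- bottom faces `b₃ = ((2,0,0),0)`, `b₂ = ((1,0,0),0)`, `b₁ = ((0,0,0),0)` of the annulus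
  have hb3 : plaq y ((2, 0, 0), 0) ∈ hexTube y := mem_Pt.2 ⟨_, by decide, rfl⟩
  have hb2 : plaq y ((1, 0, 0), 0) ∈ hexTube y := mem_Pt.2 ⟨_, by decide, rfl⟩
  have hb1 : plaq y ((0, 0, 0), 0) ∈ hexTube y := mem_Pt.2 ⟨_, by decide, rfl⟩
  refine ⟨plaq y ((2, 0, 0), 0), hb3, plaq y ((0, 0, 0), 0), hb1, ?_, ?_, ?_⟩
  · exact ⟨0, by rw [link_plaq]; exact mem_Et.2 ⟨_, by decide, rfl⟩⟩
  · exact ⟨3, by rw [link_plaq]; exact mem_Et.2 ⟨_, by decide, rfl⟩⟩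
  · refine ((Polymer.Reach.single hb3 hb2 ?_).tail hb2 hb1 ?_)
    · exact padj_plaq_of_llink (y := y) (a := 3) (b := 1) (by decide)
    · exact padj_plaq_of_llink (y := y) (a := 3) (b := 1) (by decide)

/-! ## The small-cluster sum collapses to the annulus -/

variable {N : ℕ} {G : Type*} [Group G] [TopologicalSpace G] [IsTopologicalGroup G] [CompactSpace G]
  [MeasurableSpace G] [BorelSpace G] [SecondCountableTopology G] (ρ : G →* Matrix (Fin N) (Fin N) ℂ)

open Classical in
/-- ★★ **THE SMALL JOINING CLUSTERS CONTRIBUTE ONLY THROUGH THE ANNULUS.** For bounded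
measurable `f`, `g` reading the links `Et y LE₁`, `Et y LE₂` (the mirror-image hexagon and the
hexagon), `f` gauge invariant:
`Σ_{Q ⊆ rest, TJoins Q, #Q ≤ 10} replicaTerm f g Q z = replicaTerm f g (hexTube y) z`. -/
theorem sum_replicaTerm_small_eq_hexTube (hc : 15 ≤ c) (hL : L = 2 * c)
    (hy : lay (0 : Fin 3) 1 y = ((c - 1 : ℕ) : ZMod L)) (hρ : Continuous ρ)
    {f g : GaugeConfig 3 L G → ℝ} (hfm : Measurable f) (hgm : Measurable g) {Cf Cg : ℝ}
    (hfb : ∀ U, |f U| ≤ Cf) (hgb : ∀ U, |g U| ≤ Cg) (hfinv : IsGaugeInvariant f)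
    (hfE : DependsOn f (Et y LE₁ : Set (Edge 3 L))) (hgE : DependsOn g (Et y LE₂ : Set (Edge 3 L)))
    (z : ℂ) :
    ∑ Q ∈ (restPlaqs (0 : Fin 3) 1 c).powerset.filter
        (fun Q => TJoins Q (Et y LE₁) (Et y LE₂) ∧ Q.card ≤ 10), replicaTerm ρ f g Q z =
      replicaTerm ρ f g (hexTube y) z := by
  have hL8 : 8 < L := by omega
  refine Finset.sum_eq_single_of_mem (hexTube y) ?_ fun Q hQ hne => ?_
  · rw [mem_filter, mem_powerset]
    exact ⟨hexTube_subset_restPlaqs hc hL hy, tjoins_hexTube, (card_hexTube hL8).le⟩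
  · rw [mem_filter, mem_powerset] at hQ
    rcases eq_hexTube_or_hasForestSplit hc hL hy hQ.1 hQ.2.2 with h | h
    · exact absurd h hne
    · obtain ⟨Q₁, Q₂, hQU, hdisj, hF⟩ := h.exists_gaugeFixable (G := G)
      exact replicaTerm_eq_zero_of_forestSplit ρ hρ hfm hgm hfb hgb hfinv hfE hgE hQU hdisj hF z

end DiagRPHex

end

end Summit.QuantumFields.GaugeBoot
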